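import Mathlib
import HarnessLib
import HarnessLib.Audit
import Summits.CriticalPhenomena.Statement
import Literature.Probability.RandomPlanarGeometry.ChordalCurveFamily
import Summits.CriticalPhenomena.SAWScalingLimit.Theorems.SAWPoissonBanksLSWSimpleRestrictionIsSLE

/-! Standalone elaboration of the VERBATIM signatures of items stmt-CriticalPhenomena-1372 / 4982 / 1369 / 1371
in exactly the import context of the route file `Theses/SAWConePseudogroup.lean` (its six imports, same `open` lines).
Purpose: the items carry a stale `signature_error` ("does not elaborate standalone in the context of
…CardyFormulaZ2/Theorems/CardySelfRefinementLagHandOffKernelCircuitsFail.lean" / "…PercLowPoint…") from an overnight sweep run in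
unrelated import contexts; this file shows all four elaborate in their own route context (farm `lean check`). -/

namespace Summit.CriticalPhenomena.SAWScalingLimit.Theses.SAWConePseudogroup.SigCheck

open scoped BigOperators Topology Manifold Classical MeasureTheory ProbabilityTheory Matrix InnerProductSpace ComplexConjugate ContinuousMap
open Filter Set Function TopologicalSpace MeasureTheory

/-- stmt-CriticalPhenomena-1372 verbatim. -/
def EventualTight : Prop :=
  ∀ (D : Literature.Probability.RandomPlanarGeometry.DobrushinDomain) (a b : ℝ → Literature.Probability.LatticeModels.Site 2), Literature.Probability.RandomPlanarGeometry.SAW.IsEndpointApprox D a b → ∃ δ₀ : ℝ, 0 < δ₀ ∧ MeasureTheory.IsTightMeasureSet ((fun δ => (Literature.Probability.RandomPlanarGeometry.SAW.law D.carrier δ (a δ) (b δ)).map (fun γ => γ.curve)) '' Set.Ioc 0 δ₀)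

/-- stmt-CriticalPhenomena-4982 verbatim. -/
def SimpleSubseqLimits : Prop :=
  ∀ (D : Literature.Probability.RandomPlanarGeometry.DobrushinDomain) (a b : ℝ → Literature.Probability.LatticeModels.Site 2), Literature.Probability.RandomPlanarGeometry.SAW.IsEndpointApprox D a b → ∀ (s : ℕ → ℝ) (ν : MeasureTheory.Measure (Literature.Probability.RandomPlanarGeometry.CurveClass ℂ)), Filter.Tendsto s Filter.atTop (nhdsWithin 0 (Set.Ioi 0)) → MeasureTheory.IsProbabilityMeasure ν → (∀ f : BoundedContinuousFunction (Literature.Probability.RandomPlanarGeometry.CurveClass ℂ) ℝ, Filter.Tendsto (fun n => ∫ γ, f γ.curve ∂(Literature.Probability.RandomPlanarGeometry.SAW.law D.carrier (s n) (a (s n)) (b (s n)))) Filter.atTop (nhds (∫ x, f x ∂ν))) → ∀ᵐ γ ∂ν, γ ∈ Literature.Probability.RandomPlanarGeometry.CurveClass.simple ∧ γ.source = D.pt 0 ∧ γ.target = D.pt 1 ∧ γ.range ⊆ closure D.carrier ∧ γ.range ∩ frontier D.carrier ⊆ {D.pt 0, D.pt 1}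

/-- stmt-CriticalPhenomena-1369 verbatim. -/
def AvoidanceCocycleLimit : Prop :=
  ∀ (D D' : Literature.Probability.RandomPlanarGeometry.DobrushinDomain) (a b : ℝ → Literature.Probability.LatticeModels.Site 2), Literature.Probability.RandomPlanarGeometry.SAW.IsEndpointApprox D a b → D'.carrier ⊆ D.carrier → D'.pt 0 = D.pt 0 → D'.pt 1 = D.pt 1 → (∃ ε : ℝ, 0 < ε ∧ D'.carrier ∩ Metric.ball (D.pt 0) ε = D.carrier ∩ Metric.ball (D.pt 0) ε ∧ D'.carrier ∩ Metric.ball (D.pt 1) ε = D.carrier ∩ Metric.ball (D.pt 1) ε) → ∃ c : ENNReal, Filter.Tendsto (fun δ => (((Literature.Probability.RandomPlanarGeometry.SAW.law D.carrier δ (a δ) (b δ)).map (fun γ => γ.curve)) (Literature.Probability.RandomPlanarGeometry.CurveClass.rangeSubset (closure D'.carrier)))) (nhdsWithin 0 (Set.Ioi 0)) (nhds c)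

/-- stmt-CriticalPhenomena-1371 verbatim. -/
def LimitExists' : Prop :=
  ∃ P : Literature.Probability.RandomPlanarGeometry.ChordalFamily, P.IsChordal ∧ (∀ (D : Literature.Probability.RandomPlanarGeometry.DobrushinDomain) (a b : ℝ → Literature.Probability.LatticeModels.Site 2), Literature.Probability.RandomPlanarGeometry.SAW.IsEndpointApprox D a b → Literature.Probability.RandomPlanarGeometry.TendstoLaw (fun δ (γ : Literature.Probability.RandomPlanarGeometry.SAW.DomainSAW D.carrier δ (a δ) (b δ)) => γ.curve) (fun δ => Literature.Probability.RandomPlanarGeometry.SAW.law D.carrier δ (a δ) (b δ)) id (P D))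


end Summit.CriticalPhenomena.SAWScalingLimit.Theses.SAWConePseudogroup.SigCheck
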